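import Summits.AtomisticToContinuum.Crystallization.Theorems.HullExactificationCascadeZeroDefectDensityCoordsFccGood
import HarnessLib

/-!
# Coordinates of a soft fcc shell — III: the four bad points
# (route `HullExactificationCascade`, crux `ZeroDefectDensity`, stmt-AtomisticToContinuum-12086; stub `stub_coordsFcc`)

Support file (lead c4, stub-worker) for the registered stub `stub_coordsFcc`; continuation of
`…CoordsFccGood`.  The four BAD points `p 2, p 3, p 6, p 7` are the antipodes of the frame points
`p 1, p 0, p 5, p 4`; their distance to the antipode is not pinned, so one of the frame vectors
`v₁ = p 0 + p 1`, `v₂ = p 0 - p 1`, `v₃ = p 4 - p 5` cannot be used for them.  We replace it by a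
parallel combination of GOOD points pinned to the bad point — `V₁ = p 4 + p 5 ≈ √2 e_x`,
`V₂ = p 8 + p 9 ≈ √2 e_y`, `V₃ = p 8 - p 9 ≈ √2 e_z` — whose frame coordinates are known from
`…CoordsFccGood`, and solve the (scaled) Parseval identity
`2⟪x, V⟫ = Σₖ (√2⟪x, b_k⟫)(√2⟪V, b_k⟫)` for the missing coordinate (`solve_coord`); no sign ambiguity
arises (generic lemmas `parseval_scaled`, `solve_coord` in `…CoordsFccGood`).  Contents:

* `fcc_V1`, `fcc_V2`, `fcc_V3` — frame coordinates of the three auxiliary axes;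
* `fcc_pt2`, `fcc_pt3`, `fcc_pt6`, `fcc_pt7` — the bad points (worst constant `358/10000`).

All constants were verified in exact rational arithmetic. [folklore]
-/

noncomputable section

namespace Summit.AtomisticToContinuum.Crystallization.Theorems.ZeroDefectDensityBirth

open Real RealInnerProductSpace Literature.Geometry.DiscreteGeometry

/-! ### The three auxiliary axes -/

/-- Frame coordinates of the auxiliary axis `V₁ = p 4 + p 5 ≈ (2, 0, 0)/√2` (scaled: `(2,0,0)`).
[folklore] -/
theorem fcc_V1 {p : Fin 12 → EuclideanSpace ℝ (Fin 3)} {b₁ b₂ b₃ : EuclideanSpace ℝ (Fin 3)} {n₁ n₂ n₃ s₂₁ s₃₁ s₃₂ : ℝ}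
    (hX : ∀ x : EuclideanSpace ℝ (Fin 3), ⟪x, b₁⟫ = ⟪x, p 0 + p 1⟫ / n₁)
    (hY : ∀ x : EuclideanSpace ℝ (Fin 3), ⟪x, b₂⟫ = (⟪x, p 0 - p 1⟫ - s₂₁ * ⟪x, b₁⟫) / n₂)
    (hZ : ∀ x : EuclideanSpace ℝ (Fin 3), ⟪x, b₃⟫ = (⟪x, p 4 - p 5⟫ - s₃₁ * ⟪x, b₁⟫ - s₃₂ * ⟪x, b₂⟫) / n₃)
    (hn₁ : |n₁ ^ 2 - 2| ≤ 141 / 10000) (hn₁0 : 0 < n₁) (hn₂ : |n₂ ^ 2 - 2| ≤ 141 / 10000)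
    (hn₂0 : 0 < n₂) (hn₃ : |n₃ ^ 2 - 2| ≤ 141 / 10000) (hn₃0 : 0 < n₃) (hs₂₁ : |s₂₁| ≤ 3 / 2000)
    (hs₃₁ : |s₃₁| ≤ 3 / 1000) (hs₃₂ : |s₃₂| ≤ 3 / 1000) (hub₁ : ‖b₁‖ = 1) (hub₂ : ‖b₂‖ = 1)
    (hnm : ∀ i, ‖p i‖ ≤ 1 + 1 / 4000) (hG0 : ∀ i, |⟪p i, p i⟫ - 1| ≤ 1 / 1000)
    (hG1 : ∀ i j, fccAdj i j → |⟪p i, p j⟫ - 1 / 2| ≤ 1 / 1000)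
    (hG2 : ∀ i j, sqNormInt (fccTab i - fccTab j) = 4 → |⟪p i, p j⟫| ≤ 3 / 500) :
    |Real.sqrt 2 * ⟪p 4 + p 5, b₁⟫ - 2| ≤ 23 / 1250 ∧ |Real.sqrt 2 * ⟪p 4 + p 5, b₂⟫ - 0| ≤ 9 / 1250 ∧
      |Real.sqrt 2 * ⟪p 4 + p 5, b₃⟫ - 0| ≤ 81 / 10000 := by
  obtain ⟨x4, y4, -⟩ := fcc_pt4 hX hY hZ hn₁ hn₁0 hn₂ hn₂0 hn₃ hn₃0 hs₂₁ hs₃₁ hs₃₂ hub₁ hub₂ hnm hG0 hG1 hG2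
  obtain ⟨x5, y5, -⟩ := fcc_pt5 hX hY hZ hn₁ hn₁0 hn₂ hn₂0 hn₃ hn₃0 hs₂₁ hs₃₁ hs₃₂ hub₁ hub₂ hnm hG0 hG1 hG2
  rw [show ((fccTab 4 0 : ℤ) : ℝ) = 1 by simp [fccTab]] at x4
  rw [show ((fccTab 4 1 : ℤ) : ℝ) = 0 by simp [fccTab]] at y4
  rw [show ((fccTab 5 0 : ℤ) : ℝ) = 1 by simp [fccTab]] at x5
  rw [show ((fccTab 5 1 : ℤ) : ℝ) = 0 by simp [fccTab]] at y5
  replace x4 := abs_le.1 x4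
  replace y4 := abs_le.1 y4
  replace x5 := abs_le.1 x5
  replace y5 := abs_le.1 y5
  have hx : |Real.sqrt 2 * ⟪p 4 + p 5, b₁⟫ - 2| ≤ 23 / 1250 := by
    rw [inner_add_left, mul_add, abs_le]; constructor <;> linarith [x4.1, x4.2, x5.1, x5.2]
  have hy : |Real.sqrt 2 * ⟪p 4 + p 5, b₂⟫ - 0| ≤ 9 / 1250 := by
    rw [inner_add_left, mul_add, abs_le]; constructor <;> linarith [y4.1, y4.2, y5.1, y5.2]
  have g44 := abs_le.1 (hG0 4); have g55 := abs_le.1 (hG0 5)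
  have cZ : |⟪p 4 + p 5, p 4 - p 5⟫ - 0| ≤ 1 / 500 := by
    rw [inner_add_left, inner_sub_right, inner_sub_right, real_inner_comm (p 4) (p 5), abs_le]
    constructor <;> linarith [g44.1, g44.2, g55.1, g55.2]
  have nV : ‖p 4 + p 5‖ ≤ 2 * (1 + 1 / 4000) :=
    (norm_add_le _ _).trans (by linarith [hnm 4, hnm 5])
  have a1 : |⟪p 4 + p 5, b₁⟫| ≤ 2 * (1 + 1 / 4000) := abs_inner_unit_le hub₁ nV
  have a2 : |⟪p 4 + p 5, b₂⟫| ≤ 9 / 1250 := abs_le_of_scaled hy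
  exact ⟨hx, hy, (std_Z hZ hn₃ hn₃0 hs₃₁ hs₃₂ cZ a1 a2).trans (by norm_num)⟩

/-- Frame coordinates of the auxiliary axis `V₂ = p 8 + p 9 ≈ (0, 2, 0)/√2` (scaled: `(0,2,0)`).
[folklore] -/
theorem fcc_V2 {p : Fin 12 → EuclideanSpace ℝ (Fin 3)} {b₁ b₂ b₃ : EuclideanSpace ℝ (Fin 3)} {n₁ n₂ n₃ s₂₁ s₃₁ s₃₂ : ℝ}
    (hX : ∀ x : EuclideanSpace ℝ (Fin 3), ⟪x, b₁⟫ = ⟪x, p 0 + p 1⟫ / n₁)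
    (hY : ∀ x : EuclideanSpace ℝ (Fin 3), ⟪x, b₂⟫ = (⟪x, p 0 - p 1⟫ - s₂₁ * ⟪x, b₁⟫) / n₂)
    (hZ : ∀ x : EuclideanSpace ℝ (Fin 3), ⟪x, b₃⟫ = (⟪x, p 4 - p 5⟫ - s₃₁ * ⟪x, b₁⟫ - s₃₂ * ⟪x, b₂⟫) / n₃)
    (hn₁ : |n₁ ^ 2 - 2| ≤ 141 / 10000) (hn₁0 : 0 < n₁) (hn₂ : |n₂ ^ 2 - 2| ≤ 141 / 10000)
    (hn₂0 : 0 < n₂) (hn₃ : |n₃ ^ 2 - 2| ≤ 141 / 10000) (hn₃0 : 0 < n₃) (hs₂₁ : |s₂₁| ≤ 3 / 2000)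
    (hs₃₁ : |s₃₁| ≤ 3 / 1000) (hs₃₂ : |s₃₂| ≤ 3 / 1000) (hub₁ : ‖b₁‖ = 1) (hub₂ : ‖b₂‖ = 1)
    (hnm : ∀ i, ‖p i‖ ≤ 1 + 1 / 4000) (hG1 : ∀ i j, fccAdj i j → |⟪p i, p j⟫ - 1 / 2| ≤ 1 / 1000)
    (hG3 : ∀ i j, sqNormInt (fccTab i - fccTab j) = 6 → |⟪p i, p j⟫ + 1 / 2| ≤ 3 / 500) :
    |Real.sqrt 2 * ⟪p 8 + p 9, b₁⟫ - 0| ≤ 71 / 5000 ∧ |Real.sqrt 2 * ⟪p 8 + p 9, b₂⟫ - 2| ≤ 157 / 5000 ∧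
      |Real.sqrt 2 * ⟪p 8 + p 9, b₃⟫ - 0| ≤ 101 / 5000 := by
  obtain ⟨x8, y8, -⟩ := fcc_pt8 hX hY hZ hn₁ hn₁0 hn₂ hn₂0 hn₃ hn₃0 hs₂₁ hs₃₁ hs₃₂ hub₁ hub₂ hnm hG1 hG3
  obtain ⟨x9, y9, -⟩ := fcc_pt9 hX hY hZ hn₁ hn₁0 hn₂ hn₂0 hn₃ hn₃0 hs₂₁ hs₃₁ hs₃₂ hub₁ hub₂ hnm hG1 hG3
  rw [show ((fccTab 8 0 : ℤ) : ℝ) = 0 by simp [fccTab]] at x8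
  rw [show ((fccTab 8 1 : ℤ) : ℝ) = 1 by simp [fccTab]] at y8
  rw [show ((fccTab 9 0 : ℤ) : ℝ) = 0 by simp [fccTab]] at x9
  rw [show ((fccTab 9 1 : ℤ) : ℝ) = 1 by simp [fccTab]] at y9
  replace x8 := abs_le.1 x8
  replace y8 := abs_le.1 y8
  replace x9 := abs_le.1 x9
  replace y9 := abs_le.1 y9
  have hx : |Real.sqrt 2 * ⟪p 8 + p 9, b₁⟫ - 0| ≤ 71 / 5000 := by
    rw [inner_add_left, mul_add, abs_le]; constructor <;> linarith [x8.1, x8.2, x9.1, x9.2]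
  have hy : |Real.sqrt 2 * ⟪p 8 + p 9, b₂⟫ - 2| ≤ 157 / 5000 := by
    rw [inner_add_left, mul_add, abs_le]; constructor <;> linarith [y8.1, y8.2, y9.1, y9.2]
  have g84 := abs_le.1 (hG1 8 4 (by decide)); have g85 := abs_le.1 (hG3 8 5 (by decide))
  have g94 := abs_le.1 (hG3 9 4 (by decide)); have g95 := abs_le.1 (hG1 9 5 (by decide))
  have cZ : |⟪p 8 + p 9, p 4 - p 5⟫ - 0| ≤ 7 / 500 := by
    rw [inner_add_left, inner_sub_right, inner_sub_right, abs_le]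
    constructor <;> linarith [g84.1, g84.2, g85.1, g85.2, g94.1, g94.2, g95.1, g95.2]
  have nV : ‖p 8 + p 9‖ ≤ 2 * (1 + 1 / 4000) :=
    (norm_add_le _ _).trans (by linarith [hnm 8, hnm 9])
  have a1 : |⟪p 8 + p 9, b₁⟫| ≤ 71 / 5000 := abs_le_of_scaled hx
  have a2 : |⟪p 8 + p 9, b₂⟫| ≤ 2 * (1 + 1 / 4000) := abs_inner_unit_le hub₂ nV
  exact ⟨hx, hy, (std_Z hZ hn₃ hn₃0 hs₃₁ hs₃₂ cZ a1 a2).trans (by norm_num)⟩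

/-- Frame coordinates of the auxiliary axis `V₃ = p 8 - p 9 ≈ (0, 0, 2)/√2` (scaled: `(0,0,2)`).
[folklore] -/
theorem fcc_V3 {p : Fin 12 → EuclideanSpace ℝ (Fin 3)} {b₁ b₂ b₃ : EuclideanSpace ℝ (Fin 3)} {n₁ n₂ n₃ s₂₁ s₃₁ s₃₂ : ℝ}
    (hX : ∀ x : EuclideanSpace ℝ (Fin 3), ⟪x, b₁⟫ = ⟪x, p 0 + p 1⟫ / n₁)
    (hY : ∀ x : EuclideanSpace ℝ (Fin 3), ⟪x, b₂⟫ = (⟪x, p 0 - p 1⟫ - s₂₁ * ⟪x, b₁⟫) / n₂)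
    (hZ : ∀ x : EuclideanSpace ℝ (Fin 3), ⟪x, b₃⟫ = (⟪x, p 4 - p 5⟫ - s₃₁ * ⟪x, b₁⟫ - s₃₂ * ⟪x, b₂⟫) / n₃)
    (hn₁ : |n₁ ^ 2 - 2| ≤ 141 / 10000) (hn₁0 : 0 < n₁) (hn₂ : |n₂ ^ 2 - 2| ≤ 141 / 10000)
    (hn₂0 : 0 < n₂) (hn₃ : |n₃ ^ 2 - 2| ≤ 141 / 10000) (hn₃0 : 0 < n₃) (hs₂₁ : |s₂₁| ≤ 3 / 2000)
    (hs₃₁ : |s₃₁| ≤ 3 / 1000) (hs₃₂ : |s₃₂| ≤ 3 / 1000) (hub₁ : ‖b₁‖ = 1) (hub₂ : ‖b₂‖ = 1)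
    (hnm : ∀ i, ‖p i‖ ≤ 1 + 1 / 4000) (hG1 : ∀ i j, fccAdj i j → |⟪p i, p j⟫ - 1 / 2| ≤ 1 / 1000)
    (hG3 : ∀ i j, sqNormInt (fccTab i - fccTab j) = 6 → |⟪p i, p j⟫ + 1 / 2| ≤ 3 / 500) :
    |Real.sqrt 2 * ⟪p 8 - p 9, b₁⟫ - 0| ≤ 71 / 5000 ∧ |Real.sqrt 2 * ⟪p 8 - p 9, b₂⟫ - 0| ≤ 71 / 5000 ∧
      |Real.sqrt 2 * ⟪p 8 - p 9, b₃⟫ - 2| ≤ 71 / 2500 := by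
  obtain ⟨x8, -, -⟩ := fcc_pt8 hX hY hZ hn₁ hn₁0 hn₂ hn₂0 hn₃ hn₃0 hs₂₁ hs₃₁ hs₃₂ hub₁ hub₂ hnm hG1 hG3
  obtain ⟨x9, -, -⟩ := fcc_pt9 hX hY hZ hn₁ hn₁0 hn₂ hn₂0 hn₃ hn₃0 hs₂₁ hs₃₁ hs₃₂ hub₁ hub₂ hnm hG1 hG3
  rw [show ((fccTab 8 0 : ℤ) : ℝ) = 0 by simp [fccTab]] at x8
  rw [show ((fccTab 9 0 : ℤ) : ℝ) = 0 by simp [fccTab]] at x9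
  replace x8 := abs_le.1 x8
  replace x9 := abs_le.1 x9
  have hx : |Real.sqrt 2 * ⟪p 8 - p 9, b₁⟫ - 0| ≤ 71 / 5000 := by
    rw [inner_sub_left, mul_sub, abs_le]; constructor <;> linarith [x8.1, x8.2, x9.1, x9.2]
  have g80 := abs_le.1 (hG1 8 0 (by decide)); have g81 := abs_le.1 (hG3 8 1 (by decide))
  have g90 := abs_le.1 (hG1 9 0 (by decide)); have g91 := abs_le.1 (hG3 9 1 (by decide))
  have cY : |⟪p 8 - p 9, p 0 - p 1⟫ - 0| ≤ 7 / 500 := by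
    rw [inner_sub_left, inner_sub_right, inner_sub_right, abs_le]
    constructor <;> linarith [g80.1, g80.2, g81.1, g81.2, g90.1, g90.2, g91.1, g91.2]
  have a1 : |⟪p 8 - p 9, b₁⟫| ≤ 71 / 5000 := abs_le_of_scaled hx
  have hy : |Real.sqrt 2 * ⟪p 8 - p 9, b₂⟫ - 0| ≤ 71 / 5000 :=
    (std_Y hY hn₂ hn₂0 hs₂₁ cY a1).trans (by norm_num)
  have g84 := abs_le.1 (hG1 8 4 (by decide)); have g85 := abs_le.1 (hG3 8 5 (by decide))
  have g94 := abs_le.1 (hG3 9 4 (by decide)); have g95 := abs_le.1 (hG1 9 5 (by decide))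
  have cZ : |⟪p 8 - p 9, p 4 - p 5⟫ - 2| ≤ 7 / 500 := by
    rw [inner_sub_left, inner_sub_right, inner_sub_right, abs_le]
    constructor <;> linarith [g84.1, g84.2, g85.1, g85.2, g94.1, g94.2, g95.1, g95.2]
  have a2 : |⟪p 8 - p 9, b₂⟫| ≤ 71 / 5000 := abs_le_of_scaled hy
  exact ⟨hx, hy, (std_Z hZ hn₃ hn₃0 hs₃₁ hs₃₂ cZ a1 a2).trans (by norm_num)⟩

/-! ### The four bad points -/

/-- Coordinates of the bad point `p 2` (`fccTab 2 = (-1,1,0)`, antipode of `p 1`): `z` standard, `x`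
through `V₁ = p 4 + p 5`, `y` through `V₂ = p 8 + p 9`. [folklore] -/
theorem fcc_pt2 {p : Fin 12 → EuclideanSpace ℝ (Fin 3)} {b₁ b₂ b₃ : EuclideanSpace ℝ (Fin 3)} {n₃ s₃₁ s₃₂ : ℝ}
    (hZ : ∀ x : EuclideanSpace ℝ (Fin 3), ⟪x, b₃⟫ = (⟪x, p 4 - p 5⟫ - s₃₁ * ⟪x, b₁⟫ - s₃₂ * ⟪x, b₂⟫) / n₃)
    (hn₃ : |n₃ ^ 2 - 2| ≤ 141 / 10000) (hn₃0 : 0 < n₃) (hs₃₁ : |s₃₁| ≤ 3 / 1000)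
    (hs₃₂ : |s₃₂| ≤ 3 / 1000) (hub₁ : ‖b₁‖ = 1) (hub₂ : ‖b₂‖ = 1)
    (hP : ∀ x y : EuclideanSpace ℝ (Fin 3), ⟪x, y⟫ = ⟪x, b₁⟫ * ⟪y, b₁⟫ + ⟪x, b₂⟫ * ⟪y, b₂⟫ + ⟪x, b₃⟫ * ⟪y, b₃⟫)
    (hnm : ∀ i, ‖p i‖ ≤ 1 + 1 / 4000) (hG1 : ∀ i j, fccAdj i j → |⟪p i, p j⟫ - 1 / 2| ≤ 1 / 1000)
    (hG3 : ∀ i j, sqNormInt (fccTab i - fccTab j) = 6 → |⟪p i, p j⟫ + 1 / 2| ≤ 3 / 500)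
    (hV1 : |Real.sqrt 2 * ⟪p 4 + p 5, b₁⟫ - 2| ≤ 23 / 1250 ∧
      |Real.sqrt 2 * ⟪p 4 + p 5, b₂⟫ - 0| ≤ 9 / 1250 ∧ |Real.sqrt 2 * ⟪p 4 + p 5, b₃⟫ - 0| ≤ 81 / 10000)
    (hV2 : |Real.sqrt 2 * ⟪p 8 + p 9, b₁⟫ - 0| ≤ 71 / 5000 ∧
      |Real.sqrt 2 * ⟪p 8 + p 9, b₂⟫ - 2| ≤ 157 / 5000 ∧ |Real.sqrt 2 * ⟪p 8 + p 9, b₃⟫ - 0| ≤ 101 / 5000) :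
    |Real.sqrt 2 * ⟪p 2, b₁⟫ - fccTab 2 0| ≤ 267 / 10000 ∧ |Real.sqrt 2 * ⟪p 2, b₂⟫ - fccTab 2 1| ≤ 16 / 625 ∧
      |Real.sqrt 2 * ⟪p 2, b₃⟫ - fccTab 2 2| ≤ 91 / 5000 := by
  have e0 : ((fccTab 2 0 : ℤ) : ℝ) = -1 := by simp [fccTab]
  have e1 : ((fccTab 2 1 : ℤ) : ℝ) = 1 := by simp [fccTab]
  have e2 : ((fccTab 2 2 : ℤ) : ℝ) = 0 := by simp [fccTab]
  rw [e0, e1, e2]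
  obtain ⟨v1x, v1y, v1z⟩ := hV1
  obtain ⟨v2x, v2y, v2z⟩ := hV2
  rw [sub_zero] at v1y v1z v2x v2z
  have gc := abs_le.1 (hG3 2 4 (by decide)); have gd := abs_le.1 (hG3 2 5 (by decide))
  have a1 : |⟪p 2, b₁⟫| ≤ 1 + 1 / 4000 := abs_inner_unit_le hub₁ (hnm 2)
  have a2 : |⟪p 2, b₂⟫| ≤ 1 + 1 / 4000 := abs_inner_unit_le hub₂ (hnm 2)
  -- `z`: standard (both types to `p 4`, `p 5` are `√3`)
  have cZ : |⟪p 2, p 4 - p 5⟫ - 0| ≤ 3 / 250 := by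
    rw [inner_sub_right, abs_le]; constructor <;> linarith [gc.1, gc.2, gd.1, gd.2]
  have hz : |Real.sqrt 2 * ⟪p 2, b₃⟫ - 0| ≤ 91 / 5000 :=
    (std_Z hZ hn₃ hn₃0 hs₃₁ hs₃₂ cZ a1 a2).trans (by norm_num)
  have sz := hz
  rw [sub_zero] at sz
  -- `x`: solve the Parseval identity against `V₁ = p 4 + p 5`
  have e0x : |2 * ⟪p 2, p 4 + p 5⟫ - -2| ≤ 3 / 125 := by
    rw [inner_add_right, abs_le]; constructor <;> linarith [gc.1, gc.2, gd.1, gd.2]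
  have sy : |Real.sqrt 2 * ⟪p 2, b₂⟫| ≤ 283 / 200 := abs_scaled_le hub₂ (hnm 2)
  have hx : |Real.sqrt 2 * ⟪p 2, b₁⟫ - -1| ≤ 267 / 10000 := by
    have h := solve_coord (parseval_scaled hP (p 2) (p 4 + p 5)) e0x sy v1y sz v1z v1x (by norm_num)
    rw [show (-2 : ℝ) / 2 = -1 by norm_num] at h
    exact h.trans (by norm_num)
  -- `y`: solve the Parseval identity against `V₂ = p 8 + p 9`
  have g8 := abs_le.1 (hG1 2 8 (by decide)); have g9 := abs_le.1 (hG1 2 9 (by decide))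
  have e0y : |2 * ⟪p 2, p 8 + p 9⟫ - 2| ≤ 1 / 250 := by
    rw [inner_add_right, abs_le]; constructor <;> linarith [g8.1, g8.2, g9.1, g9.2]
  have sx : |Real.sqrt 2 * ⟪p 2, b₁⟫| ≤ 1 + 267 / 10000 := by
    have h' := abs_le.1 hx
    rw [abs_le]; constructor <;> linarith [h'.1, h'.2]
  have hP2 : 2 * ⟪p 2, p 8 + p 9⟫ =
      (Real.sqrt 2 * ⟪p 2, b₂⟫) * (Real.sqrt 2 * ⟪p 8 + p 9, b₂⟫) +
      (Real.sqrt 2 * ⟪p 2, b₁⟫) * (Real.sqrt 2 * ⟪p 8 + p 9, b₁⟫) +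
      (Real.sqrt 2 * ⟪p 2, b₃⟫) * (Real.sqrt 2 * ⟪p 8 + p 9, b₃⟫) := by
    linear_combination parseval_scaled hP (p 2) (p 8 + p 9)
  have hy : |Real.sqrt 2 * ⟪p 2, b₂⟫ - 1| ≤ 16 / 625 := by
    have h := solve_coord hP2 e0y sx v2x sz v2z v2y (by norm_num)
    rw [show (2 : ℝ) / 2 = 1 by norm_num] at h
    exact h.trans (by norm_num)
  exact ⟨hx, hy, hz⟩

/-- Coordinates of the bad point `p 3` (`fccTab 3 = (-1,-1,0)`, antipode of `p 0`): `z` standard,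
`x` through `V₁ = p 4 + p 5`, `y` through `V₂ = p 8 + p 9`. [folklore] -/
theorem fcc_pt3 {p : Fin 12 → EuclideanSpace ℝ (Fin 3)} {b₁ b₂ b₃ : EuclideanSpace ℝ (Fin 3)} {n₃ s₃₁ s₃₂ : ℝ}
    (hZ : ∀ x : EuclideanSpace ℝ (Fin 3), ⟪x, b₃⟫ = (⟪x, p 4 - p 5⟫ - s₃₁ * ⟪x, b₁⟫ - s₃₂ * ⟪x, b₂⟫) / n₃)
    (hn₃ : |n₃ ^ 2 - 2| ≤ 141 / 10000) (hn₃0 : 0 < n₃) (hs₃₁ : |s₃₁| ≤ 3 / 1000)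
    (hs₃₂ : |s₃₂| ≤ 3 / 1000) (hub₁ : ‖b₁‖ = 1) (hub₂ : ‖b₂‖ = 1)
    (hP : ∀ x y : EuclideanSpace ℝ (Fin 3), ⟪x, y⟫ = ⟪x, b₁⟫ * ⟪y, b₁⟫ + ⟪x, b₂⟫ * ⟪y, b₂⟫ + ⟪x, b₃⟫ * ⟪y, b₃⟫)
    (hnm : ∀ i, ‖p i‖ ≤ 1 + 1 / 4000)
    (hG3 : ∀ i j, sqNormInt (fccTab i - fccTab j) = 6 → |⟪p i, p j⟫ + 1 / 2| ≤ 3 / 500)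
    (hV1 : |Real.sqrt 2 * ⟪p 4 + p 5, b₁⟫ - 2| ≤ 23 / 1250 ∧
      |Real.sqrt 2 * ⟪p 4 + p 5, b₂⟫ - 0| ≤ 9 / 1250 ∧ |Real.sqrt 2 * ⟪p 4 + p 5, b₃⟫ - 0| ≤ 81 / 10000)
    (hV2 : |Real.sqrt 2 * ⟪p 8 + p 9, b₁⟫ - 0| ≤ 71 / 5000 ∧
      |Real.sqrt 2 * ⟪p 8 + p 9, b₂⟫ - 2| ≤ 157 / 5000 ∧ |Real.sqrt 2 * ⟪p 8 + p 9, b₃⟫ - 0| ≤ 101 / 5000) :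
    |Real.sqrt 2 * ⟪p 3, b₁⟫ - fccTab 3 0| ≤ 267 / 10000 ∧ |Real.sqrt 2 * ⟪p 3, b₂⟫ - fccTab 3 1| ≤ 179 / 5000 ∧
      |Real.sqrt 2 * ⟪p 3, b₃⟫ - fccTab 3 2| ≤ 91 / 5000 := by
  have e0 : ((fccTab 3 0 : ℤ) : ℝ) = -1 := by simp [fccTab]
  have e1 : ((fccTab 3 1 : ℤ) : ℝ) = -1 := by simp [fccTab]
  have e2 : ((fccTab 3 2 : ℤ) : ℝ) = 0 := by simp [fccTab]
  rw [e0, e1, e2]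
  obtain ⟨v1x, v1y, v1z⟩ := hV1
  obtain ⟨v2x, v2y, v2z⟩ := hV2
  rw [sub_zero] at v1y v1z v2x v2z
  have gc := abs_le.1 (hG3 3 4 (by decide)); have gd := abs_le.1 (hG3 3 5 (by decide))
  have a1 : |⟪p 3, b₁⟫| ≤ 1 + 1 / 4000 := abs_inner_unit_le hub₁ (hnm 3)
  have a2 : |⟪p 3, b₂⟫| ≤ 1 + 1 / 4000 := abs_inner_unit_le hub₂ (hnm 3)
  -- `z`: standard (both types to `p 4`, `p 5` are `√3`)
  have cZ : |⟪p 3, p 4 - p 5⟫ - 0| ≤ 3 / 250 := by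
    rw [inner_sub_right, abs_le]; constructor <;> linarith [gc.1, gc.2, gd.1, gd.2]
  have hz : |Real.sqrt 2 * ⟪p 3, b₃⟫ - 0| ≤ 91 / 5000 :=
    (std_Z hZ hn₃ hn₃0 hs₃₁ hs₃₂ cZ a1 a2).trans (by norm_num)
  have sz := hz
  rw [sub_zero] at sz
  -- `x`: solve the Parseval identity against `V₁ = p 4 + p 5`
  have e0x : |2 * ⟪p 3, p 4 + p 5⟫ - -2| ≤ 3 / 125 := by
    rw [inner_add_right, abs_le]; constructor <;> linarith [gc.1, gc.2, gd.1, gd.2]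
  have sy : |Real.sqrt 2 * ⟪p 3, b₂⟫| ≤ 283 / 200 := abs_scaled_le hub₂ (hnm 3)
  have hx : |Real.sqrt 2 * ⟪p 3, b₁⟫ - -1| ≤ 267 / 10000 := by
    have h := solve_coord (parseval_scaled hP (p 3) (p 4 + p 5)) e0x sy v1y sz v1z v1x (by norm_num)
    rw [show (-2 : ℝ) / 2 = -1 by norm_num] at h
    exact h.trans (by norm_num)
  -- `y`: solve the Parseval identity against `V₂ = p 8 + p 9`
  have g8 := abs_le.1 (hG3 3 8 (by decide)); have g9 := abs_le.1 (hG3 3 9 (by decide))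
  have e0y : |2 * ⟪p 3, p 8 + p 9⟫ - -2| ≤ 3 / 125 := by
    rw [inner_add_right, abs_le]; constructor <;> linarith [g8.1, g8.2, g9.1, g9.2]
  have sx : |Real.sqrt 2 * ⟪p 3, b₁⟫| ≤ 1 + 267 / 10000 := by
    have h' := abs_le.1 hx
    rw [abs_le]; constructor <;> linarith [h'.1, h'.2]
  have hP2 : 2 * ⟪p 3, p 8 + p 9⟫ =
      (Real.sqrt 2 * ⟪p 3, b₂⟫) * (Real.sqrt 2 * ⟪p 8 + p 9, b₂⟫) +
      (Real.sqrt 2 * ⟪p 3, b₁⟫) * (Real.sqrt 2 * ⟪p 8 + p 9, b₁⟫) +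
      (Real.sqrt 2 * ⟪p 3, b₃⟫) * (Real.sqrt 2 * ⟪p 8 + p 9, b₃⟫) := by
    linear_combination parseval_scaled hP (p 3) (p 8 + p 9)
  have hy : |Real.sqrt 2 * ⟪p 3, b₂⟫ - -1| ≤ 179 / 5000 := by
    have h := solve_coord hP2 e0y sx v2x sz v2z v2y (by norm_num)
    rw [show (-2 : ℝ) / 2 = -1 by norm_num] at h
    exact h.trans (by norm_num)
  exact ⟨hx, hy, hz⟩

/-- Coordinates of the bad point `p 6` (`fccTab 6 = (-1,0,1)`, antipode of `p 5`): `x`, `y`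
standard, `z` through `V₃ = p 8 - p 9`. [folklore] -/
theorem fcc_pt6 {p : Fin 12 → EuclideanSpace ℝ (Fin 3)} {b₁ b₂ b₃ : EuclideanSpace ℝ (Fin 3)} {n₁ n₂ s₂₁ : ℝ}
    (hX : ∀ x : EuclideanSpace ℝ (Fin 3), ⟪x, b₁⟫ = ⟪x, p 0 + p 1⟫ / n₁)
    (hY : ∀ x : EuclideanSpace ℝ (Fin 3), ⟪x, b₂⟫ = (⟪x, p 0 - p 1⟫ - s₂₁ * ⟪x, b₁⟫) / n₂)
    (hn₁ : |n₁ ^ 2 - 2| ≤ 141 / 10000) (hn₁0 : 0 < n₁) (hn₂ : |n₂ ^ 2 - 2| ≤ 141 / 10000)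
    (hn₂0 : 0 < n₂) (hs₂₁ : |s₂₁| ≤ 3 / 2000) (hub₁ : ‖b₁‖ = 1)
    (hP : ∀ x y : EuclideanSpace ℝ (Fin 3), ⟪x, y⟫ = ⟪x, b₁⟫ * ⟪y, b₁⟫ + ⟪x, b₂⟫ * ⟪y, b₂⟫ + ⟪x, b₃⟫ * ⟪y, b₃⟫)
    (hnm : ∀ i, ‖p i‖ ≤ 1 + 1 / 4000) (hG1 : ∀ i j, fccAdj i j → |⟪p i, p j⟫ - 1 / 2| ≤ 1 / 1000)
    (hG3 : ∀ i j, sqNormInt (fccTab i - fccTab j) = 6 → |⟪p i, p j⟫ + 1 / 2| ≤ 3 / 500)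
    (hV3 : |Real.sqrt 2 * ⟪p 8 - p 9, b₁⟫ - 0| ≤ 71 / 5000 ∧
      |Real.sqrt 2 * ⟪p 8 - p 9, b₂⟫ - 0| ≤ 71 / 5000 ∧ |Real.sqrt 2 * ⟪p 8 - p 9, b₃⟫ - 2| ≤ 71 / 2500) :
    |Real.sqrt 2 * ⟪p 6, b₁⟫ - fccTab 6 0| ≤ 12 / 625 ∧ |Real.sqrt 2 * ⟪p 6, b₂⟫ - fccTab 6 1| ≤ 17 / 1250 ∧
      |Real.sqrt 2 * ⟪p 6, b₃⟫ - fccTab 6 2| ≤ 29 / 1000 := by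
  have e0 : ((fccTab 6 0 : ℤ) : ℝ) = -1 := by simp [fccTab]
  have e1 : ((fccTab 6 1 : ℤ) : ℝ) = 0 := by simp [fccTab]
  have e2 : ((fccTab 6 2 : ℤ) : ℝ) = 1 := by simp [fccTab]
  rw [e0, e1, e2]
  obtain ⟨v3x, v3y, v3z⟩ := hV3
  rw [sub_zero] at v3x v3y
  have ga := abs_le.1 (hG3 6 0 (by decide)); have gb := abs_le.1 (hG3 6 1 (by decide))
  have a1 : |⟪p 6, b₁⟫| ≤ 1 + 1 / 4000 := abs_inner_unit_le hub₁ (hnm 6)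
  -- `x`, `y`: standard (both types to `p 0`, `p 1` are `√3`)
  have cX : |⟪p 6, p 0 + p 1⟫ - -1| ≤ 3 / 250 := by
    rw [inner_add_right, abs_le]; constructor <;> linarith [ga.1, ga.2, gb.1, gb.2]
  have cY : |⟪p 6, p 0 - p 1⟫ - 0| ≤ 3 / 250 := by
    rw [inner_sub_right, abs_le]; constructor <;> linarith [ga.1, ga.2, gb.1, gb.2]
  have hx : |Real.sqrt 2 * ⟪p 6, b₁⟫ - -1| ≤ 12 / 625 := (std_X hX hn₁ hn₁0 cX).trans (by norm_num)
  have hy : |Real.sqrt 2 * ⟪p 6, b₂⟫ - 0| ≤ 17 / 1250 :=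
    (std_Y hY hn₂ hn₂0 hs₂₁ cY a1).trans (by norm_num)
  -- `z`: solve the Parseval identity against `V₃ = p 8 - p 9`
  have g8 := abs_le.1 (hG1 6 8 (by decide)); have g9 := abs_le.1 (hG3 6 9 (by decide))
  have e0z : |2 * ⟪p 6, p 8 - p 9⟫ - 2| ≤ 7 / 500 := by
    rw [inner_sub_right, abs_le]; constructor <;> linarith [g8.1, g8.2, g9.1, g9.2]
  have sx : |Real.sqrt 2 * ⟪p 6, b₁⟫| ≤ 1 + 12 / 625 := by
    have h' := abs_le.1 hx
    rw [abs_le]; constructor <;> linarith [h'.1, h'.2]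
  have sy : |Real.sqrt 2 * ⟪p 6, b₂⟫| ≤ 17 / 1250 := by
    have h' := hy
    rw [sub_zero] at h'
    exact h'
  have hP3 : 2 * ⟪p 6, p 8 - p 9⟫ =
      (Real.sqrt 2 * ⟪p 6, b₃⟫) * (Real.sqrt 2 * ⟪p 8 - p 9, b₃⟫) +
      (Real.sqrt 2 * ⟪p 6, b₁⟫) * (Real.sqrt 2 * ⟪p 8 - p 9, b₁⟫) +
      (Real.sqrt 2 * ⟪p 6, b₂⟫) * (Real.sqrt 2 * ⟪p 8 - p 9, b₂⟫) := by
    linear_combination parseval_scaled hP (p 6) (p 8 - p 9)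
  have hz : |Real.sqrt 2 * ⟪p 6, b₃⟫ - 1| ≤ 29 / 1000 := by
    have h := solve_coord hP3 e0z sx v3x sy v3y v3z (by norm_num)
    rw [show (2 : ℝ) / 2 = 1 by norm_num] at h
    exact h.trans (by norm_num)
  exact ⟨hx, hy, hz⟩

/-- Coordinates of the bad point `p 7` (`fccTab 7 = (-1,0,-1)`, antipode of `p 4`): `x`, `y`
standard, `z` through `V₃ = p 8 - p 9`. [folklore] -/
theorem fcc_pt7 {p : Fin 12 → EuclideanSpace ℝ (Fin 3)} {b₁ b₂ b₃ : EuclideanSpace ℝ (Fin 3)} {n₁ n₂ s₂₁ : ℝ}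
    (hX : ∀ x : EuclideanSpace ℝ (Fin 3), ⟪x, b₁⟫ = ⟪x, p 0 + p 1⟫ / n₁)
    (hY : ∀ x : EuclideanSpace ℝ (Fin 3), ⟪x, b₂⟫ = (⟪x, p 0 - p 1⟫ - s₂₁ * ⟪x, b₁⟫) / n₂)
    (hn₁ : |n₁ ^ 2 - 2| ≤ 141 / 10000) (hn₁0 : 0 < n₁) (hn₂ : |n₂ ^ 2 - 2| ≤ 141 / 10000)
    (hn₂0 : 0 < n₂) (hs₂₁ : |s₂₁| ≤ 3 / 2000) (hub₁ : ‖b₁‖ = 1)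
    (hP : ∀ x y : EuclideanSpace ℝ (Fin 3), ⟪x, y⟫ = ⟪x, b₁⟫ * ⟪y, b₁⟫ + ⟪x, b₂⟫ * ⟪y, b₂⟫ + ⟪x, b₃⟫ * ⟪y, b₃⟫)
    (hnm : ∀ i, ‖p i‖ ≤ 1 + 1 / 4000) (hG1 : ∀ i j, fccAdj i j → |⟪p i, p j⟫ - 1 / 2| ≤ 1 / 1000)
    (hG3 : ∀ i j, sqNormInt (fccTab i - fccTab j) = 6 → |⟪p i, p j⟫ + 1 / 2| ≤ 3 / 500)
    (hV3 : |Real.sqrt 2 * ⟪p 8 - p 9, b₁⟫ - 0| ≤ 71 / 5000 ∧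
      |Real.sqrt 2 * ⟪p 8 - p 9, b₂⟫ - 0| ≤ 71 / 5000 ∧ |Real.sqrt 2 * ⟪p 8 - p 9, b₃⟫ - 2| ≤ 71 / 2500) :
    |Real.sqrt 2 * ⟪p 7, b₁⟫ - fccTab 7 0| ≤ 12 / 625 ∧ |Real.sqrt 2 * ⟪p 7, b₂⟫ - fccTab 7 1| ≤ 17 / 1250 ∧
      |Real.sqrt 2 * ⟪p 7, b₃⟫ - fccTab 7 2| ≤ 29 / 1000 := by
  have e0 : ((fccTab 7 0 : ℤ) : ℝ) = -1 := by simp [fccTab]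
  have e1 : ((fccTab 7 1 : ℤ) : ℝ) = 0 := by simp [fccTab]
  have e2 : ((fccTab 7 2 : ℤ) : ℝ) = -1 := by simp [fccTab]
  rw [e0, e1, e2]
  obtain ⟨v3x, v3y, v3z⟩ := hV3
  rw [sub_zero] at v3x v3y
  have ga := abs_le.1 (hG3 7 0 (by decide)); have gb := abs_le.1 (hG3 7 1 (by decide))
  have a1 : |⟪p 7, b₁⟫| ≤ 1 + 1 / 4000 := abs_inner_unit_le hub₁ (hnm 7)
  -- `x`, `y`: standard (both types to `p 0`, `p 1` are `√3`)
  have cX : |⟪p 7, p 0 + p 1⟫ - -1| ≤ 3 / 250 := by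
    rw [inner_add_right, abs_le]; constructor <;> linarith [ga.1, ga.2, gb.1, gb.2]
  have cY : |⟪p 7, p 0 - p 1⟫ - 0| ≤ 3 / 250 := by
    rw [inner_sub_right, abs_le]; constructor <;> linarith [ga.1, ga.2, gb.1, gb.2]
  have hx : |Real.sqrt 2 * ⟪p 7, b₁⟫ - -1| ≤ 12 / 625 := (std_X hX hn₁ hn₁0 cX).trans (by norm_num)
  have hy : |Real.sqrt 2 * ⟪p 7, b₂⟫ - 0| ≤ 17 / 1250 :=
    (std_Y hY hn₂ hn₂0 hs₂₁ cY a1).trans (by norm_num)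
  -- `z`: solve the Parseval identity against `V₃ = p 8 - p 9`
  have g8 := abs_le.1 (hG3 7 8 (by decide)); have g9 := abs_le.1 (hG1 7 9 (by decide))
  have e0z : |2 * ⟪p 7, p 8 - p 9⟫ - -2| ≤ 7 / 500 := by
    rw [inner_sub_right, abs_le]; constructor <;> linarith [g8.1, g8.2, g9.1, g9.2]
  have sx : |Real.sqrt 2 * ⟪p 7, b₁⟫| ≤ 1 + 12 / 625 := by
    have h' := abs_le.1 hx
    rw [abs_le]; constructor <;> linarith [h'.1, h'.2]
  have sy : |Real.sqrt 2 * ⟪p 7, b₂⟫| ≤ 17 / 1250 := by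
    have h' := hy
    rw [sub_zero] at h'
    exact h'
  have hP3 : 2 * ⟪p 7, p 8 - p 9⟫ =
      (Real.sqrt 2 * ⟪p 7, b₃⟫) * (Real.sqrt 2 * ⟪p 8 - p 9, b₃⟫) +
      (Real.sqrt 2 * ⟪p 7, b₁⟫) * (Real.sqrt 2 * ⟪p 8 - p 9, b₁⟫) +
      (Real.sqrt 2 * ⟪p 7, b₂⟫) * (Real.sqrt 2 * ⟪p 8 - p 9, b₂⟫) := by
    linear_combination parseval_scaled hP (p 7) (p 8 - p 9)
  have hz : |Real.sqrt 2 * ⟪p 7, b₃⟫ - -1| ≤ 29 / 1000 := by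
    have h := solve_coord hP3 e0z sx v3x sy v3y v3z (by norm_num)
    rw [show (-2 : ℝ) / 2 = -1 by norm_num] at h
    exact h.trans (by norm_num)
  exact ⟨hx, hy, hz⟩


/-! ### Registered sub-goal (one line, fully qualified) -/

/-- **Registered sub-goal `fcc_bad_pt7`** (helper of `stub_coordsFcc`, lead c4): the coordinate bound of
the bad point `p 7`, verbatim the registered one-line signature (`= fcc_pt7`). [folklore] -/
theorem fcc_bad_pt7 : ∀ {p : Fin 12 → EuclideanSpace ℝ (Fin 3)} {b₁ b₂ b₃ : EuclideanSpace ℝ (Fin 3)} {n₁ n₂ s₂₁ : ℝ}, (∀ x : EuclideanSpace ℝ (Fin 3), inner ℝ (x) (b₁) = inner ℝ (x) (p 0 + p 1) / n₁) → (∀ x : EuclideanSpace ℝ (Fin 3), inner ℝ (x) (b₂) = (inner ℝ (x) (p 0 - p 1) - s₂₁ * inner ℝ (x) (b₁)) / n₂) → (|n₁ ^ 2 - 2| ≤ 141 / 10000) → (0 < n₁) → (|n₂ ^ 2 - 2| ≤ 141 / 10000) → (0 < n₂) → (|s₂₁| ≤ 3 / 2000) → (‖b₁‖ = 1) → (∀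 x y : EuclideanSpace ℝ (Fin 3), inner ℝ (x) (y) = inner ℝ (x) (b₁) * inner ℝ (y) (b₁) + inner ℝ (x) (b₂) * inner ℝ (y) (b₂) + inner ℝ (x) (b₃) * inner ℝ (y) (b₃)) → (∀ i, ‖p i‖ ≤ 1 + 1 / 4000) → (∀ i j, Literature.Geometry.DiscreteGeometry.fccAdj i j → |inner ℝ (p i) (p j) - 1 / 2| ≤ 1 / 1000) → (∀ i j, Literature.Geometry.DiscreteGeometry.sqNormInt (Literature.Geometry.DiscreteGeometry.fccTab i - Literature.Geometry.DiscreteGeometry.fccTab j) = 6 → |inner ℝ (p i) (p j) + 1 / 2| ≤ 3 / 500) → (|Real.sqrt 2 * inner ℝ (p 8 - p 9) (b₁) - 0| ≤ 71 / 5000 ∧ |Real.sqrt 2 * inner ℝ (p 8 - p 9) (b₂) - 0| ≤ 71 / 5000 ∧ |Real.sqrt 2 * inner ℝ (p 8 - p 9) (b₃) - 2| ≤ 71 / 2500) → |Real.sqrt 2 * inner ℝ (p 7) (b₁) - Literature.Geometry.DiscreteGeometry.fccTab 7 0| ≤ 12 / 625 ∧ |Real.sqrt 2 * inner ℝ (p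 7) (b₂) - Literature.Geometry.DiscreteGeometry.fccTab 7 1| ≤ 17 / 1250 ∧ |Real.sqrt 2 * inner ℝ (p 7) (b₃) - Literature.Geometry.DiscreteGeometry.fccTab 7 2| ≤ 29 / 1000 :=
  fcc_pt7

end Summit.AtomisticToContinuum.Crystallization.Theorems.ZeroDefectDensityBirth

end
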